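import Literature.AnabelianGeometry.SemiGraphs.MetabelianLeafStarEscapeIsolated
import HarnessLib

/-!
# Two compact subgroups of `π₁^temp(𝒢)` sharing an element with an edge certificate generate a compact subgroup
# (the two-level TREE BRIDGE of `MetabelianLeafStarEscapeIsolated.lean` made generic)

Mochizuki, *Semi-graphs of anabelioids*, Publ. RIMS **42** (2006), §1, Lemma 1.8 (ii) p. 20 ("`Γ` acts
trivially on any 'geodesic' [i.e., path of closed edges of minimal length] that joins `w₁`, `w₂`" — print's
`G`, `w₁`, `w₂` adapted), §3, Theorem 3.7 (iii)/(iv) pp. 40–41 [cite: MochizukiSemiAnbd2006, Thm 3.7(iv) p.41].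

PROOF-ONLY tool file (abc-iut cell, layer L3, row «EXOTIC-ISOLATION@STAR», seat abc-iut-L3-t8 gen 9; no
definition, no named fact).  For ANY countable semi-graph of anabelioids `𝒢` satisfying the hypotheses of
Prop. 3.6, all of whose branches abut (no open edges), in the canonical tower `𝒢_{∞,n}` of
`TemperedPiSystem.lean`:

* `SemiGraph.exists_edge_forall_walk_mem_support_of_family` — Lemma 1.8 (ii) bridge form for two FAMILIES of
  tree automorphisms (gen 8's `exists_edge_forall_walk_mem_support` was the one-element case): if no vertex is
  fixed by both families, one edge-point lies on every subdivision walk from a vertex fixed by the first family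
  to a vertex fixed by the second;
* `exists_common_fixed_vertex_of_certificate` — **TWO-LEVEL BRIDGE**: let `K₁, K₂ ≤ π₁^temp(𝒢)` be compact and
  `d ∈ K₁ ⊓ K₂` carry an EDGE CERTIFICATE («for every base edge `n`, from some level on `d` fixes no edge of
  `𝒢_{∞,M}` over `n`»); then at EVERY level `K₁` and `K₂` fix a common vertex (else the bridge edge `e₀` of a
  level `m`, over `n₀`, would be hit by the `d`-fixed geodesic joining a `K₁`-fixed to a `K₂`-fixed vertex of a
  deep level `M ≥ M₀(n₀)`);
* `isCompact_topologicalClosure_sup_of_certificate` — hence `(K₁ ⊔ K₂)‾` is COMPACT (finite level images);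
* `le_of_isMaximalCompactSubgroup_of_certificate` — and if `K₂` is a maximal compact subgroup, `K₁ ≤ K₂`.

Consumer: the isolation of EVERY exotic maximal compact subgroup of `π₁^temp(𝒢⋆(p))`
(`MetabelianLeafStarExoticIsolation.lean`).  Nothing here bears on [IUTchIII] Cor. 3.12; no side taken;
typed ≠ proved.
-/

noncomputable section

open CategoryTheory Topology

namespace Literature.AnabelianGeometry.SemiGraphs

open SimpleGraph

universe u

namespace SemiGraph

variable {T : SemiGraph.{u}}

/-! ### Lemma 1.8 (ii), bridge form, for two families of automorphisms -/

/-- **Two families of tree automorphisms without a common fixed vertex are separated by an edge-point** lying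
on every walk of the barycentric subdivision from a vertex fixed by (every member of) the first family to a
vertex fixed by the second (automorphisms without inversions, all branches abutting, each family with some fixed
vertex). [cite: MochizukiSemiAnbd2006, Lem. 1.8(ii)(b) p.20] -/
theorem exists_edge_forall_walk_mem_support_of_family (hT : T.IsTree) (Φ Ψ : Set (Aut T))
    (hbr : ∀ β : T.Branch, ∃ z : T.Vertex, T.abuts β = some z)
    (hΦ : ∀ φ ∈ Φ, ∀ e : T.Edge, φ.hom.edgeMap e = e → ∀ β : T.Branch, T.edgeOf β = e → φ.hom.branchMap β = β)
    (hΨ : ∀ ψ ∈ Ψ, ∀ e : T.Edge, ψ.hom.edgeMap e = e → ∀ β : T.Branch, T.edgeOf β = e → ψ.hom.branchMap β = β)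
    {a₀ b₀ : T.Vertex} (ha₀ : ∀ φ ∈ Φ, φ.hom.vertexMap a₀ = a₀) (hb₀ : ∀ ψ ∈ Ψ, ψ.hom.vertexMap b₀ = b₀)
    (hno : ∀ z : T.Vertex, (∀ φ ∈ Φ, φ.hom.vertexMap z = z) → ¬ ∀ ψ ∈ Ψ, ψ.hom.vertexMap z = z) :
    ∃ e₀ : T.Edge, ∀ a b : T.Vertex, (∀ φ ∈ Φ, φ.hom.vertexMap a = a) → (∀ ψ ∈ Ψ, ψ.hom.vertexMap b = b) →
      ∀ w : T.subdivision.Walk (Sum.inl a) (Sum.inl b), (Sum.inr (Sum.inl e₀) : T.Node) ∈ w.support := by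
  classical
  -- the fixed loci as node sets: convex, disjoint, non-empty
  set A : Set T.Node := {x | ∀ φ ∈ Φ, nodeMap φ x = x} with hAdef
  set B : Set T.Node := {x | ∀ ψ ∈ Ψ, nodeMap ψ x = x} with hBdef
  have hA : ∀ x ∈ A, ∀ y ∈ A, ∀ q : T.subdivision.Walk x y, q.IsPath → ∀ z ∈ q.support, z ∈ A :=
    fun x hx y hy q hq z hz φ hφ => nodeMap_eq_self_of_isPath hT.isTree.isAcyclic φ (hx φ hφ) (hy φ hφ) q hq z hz
  have hB : ∀ x ∈ B, ∀ y ∈ B, ∀ q : T.subdivision.Walk x y, q.IsPath → ∀ z ∈ q.support, z ∈ B :=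
    fun x hx y hy q hq z hz ψ hψ => nodeMap_eq_self_of_isPath hT.isTree.isAcyclic ψ (hx ψ hψ) (hy ψ hψ) q hq z hz
  -- a common fixed edge or branch would give a common fixed vertex
  have hfixE : ∀ (χ : Aut T), (∀ e : T.Edge, χ.hom.edgeMap e = e → ∀ β : T.Branch, T.edgeOf β = e →
      χ.hom.branchMap β = β) → ∀ e : T.Edge, χ.hom.edgeMap e = e →
      ∀ β : T.Branch, T.edgeOf β = e → ∀ z, T.abuts β = some z → χ.hom.vertexMap z = z :=
    fun χ hχ e he β hβe z hz => vertexMap_eq_of_branchMap_eq χ (hχ e he β hβe) hz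
  have hAB : Disjoint A B := by
    rw [Set.disjoint_left]
    rintro x hx hx'
    change ∀ φ ∈ Φ, nodeMap φ x = x at hx
    change ∀ ψ ∈ Ψ, nodeMap ψ x = x at hx'
    rcases x with z | e | β
    · simp only [nodeMap_inl, Sum.inl.injEq] at hx hx'
      exact hno z hx hx'
    · simp only [nodeMap_inr_inl, Sum.inr.injEq, Sum.inl.injEq] at hx hx'
      obtain ⟨β, -, -, hβe, -, -⟩ := T.two_branches e
      obtain ⟨z, hz⟩ := hbr β
      exact hno z (fun φ hφ => hfixE φ (hΦ φ hφ) e (hx φ hφ) β hβe z hz)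
        (fun ψ hψ => hfixE ψ (hΨ ψ hψ) e (hx' ψ hψ) β hβe z hz)
    · simp only [nodeMap_inr_inr, Sum.inr.injEq] at hx hx'
      obtain ⟨z, hz⟩ := hbr β
      exact hno z (fun φ hφ => vertexMap_eq_of_branchMap_eq φ (hx φ hφ) hz)
        (fun ψ hψ => vertexMap_eq_of_branchMap_eq ψ (hx' ψ hψ) hz)
  have hmemA : ∀ a : T.Vertex, (∀ φ ∈ Φ, φ.hom.vertexMap a = a) → (Sum.inl a : T.Node) ∈ A := fun a ha φ hφ => by
    rw [nodeMap_inl, ha φ hφ]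
  have hmemB : ∀ b : T.Vertex, (∀ ψ ∈ Ψ, ψ.hom.vertexMap b = b) → (Sum.inl b : T.Node) ∈ B := fun b hb ψ hψ => by
    rw [nodeMap_inl, hb ψ hψ]
  obtain ⟨u, v, huA, hvA, huv, hsep⟩ := hT.isTree.exists_adj_forall_walk_mem_edges hA hB hAB
    ⟨_, hmemA a₀ ha₀⟩ ⟨_, hmemB b₀ hb₀⟩
  change ∀ φ ∈ Φ, nodeMap φ u = u at huA
  rcases u with z | e | β
  · -- `u = z` a vertex, `v = β` a branch at `z` not fixed by all of `Φ`: the edge-point of `β` separates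
    obtain ⟨β, hβz, rfl⟩ := (T.subdivision_adj_inl_iff z v).mp huv
    refine ⟨T.edgeOf β, fun a b ha hb w => ?_⟩
    have hq := hsep _ (hmemA a ha) _ (hmemB b hb) w.bypass
    have hβmem : (Sum.inr (Sum.inr β) : T.Node) ∈ w.bypass.support :=
      Walk.snd_mem_support_of_mem_edges _ hq
    obtain ⟨x, y, hx, hy, hxy, hxβ, hβy⟩ := exists_adj_adj_of_mem_support w.bypass w.bypass_isPath hβmem
      (by simp) (by simp)
    have hnb : ∀ n : T.Node, T.subdivision.Adj (Sum.inr (Sum.inr β)) n →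
        n = Sum.inr (Sum.inl (T.edgeOf β)) ∨ n = Sum.inl z := by
      intro n hn
      rcases (T.subdivision_adj_branch_iff β n).mp hn with h | ⟨z', hz', h⟩
      · exact Or.inl h
      · rw [hβz] at hz'
        rw [← Option.some.inj hz'] at h
        exact Or.inr h
    rcases hnb x hxβ.symm with hx' | hx'
    · rw [hx'] at hx
      exact w.support_bypass_subset_support hx
    · rcases hnb y hβy with hy' | hy'
      · rw [hy'] at hy
        exact w.support_bypass_subset_support hy
      · exact absurd (hx'.trans hy'.symm) hxy
  · -- `u = e` an edge-point fixed by all of `Φ`: it separates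
    refine ⟨e, fun a b ha hb w => ?_⟩
    exact Walk.fst_mem_support_of_mem_edges _ (hsep _ (hmemA a ha) _ (hmemB b hb) w)
  · -- `u = β` a branch fixed by all of `Φ`: its neighbours (its edge, its vertex) are fixed too — impossible
    exfalso
    simp only [nodeMap_inr_inr, Sum.inr.injEq] at huA
    apply hvA
    rcases (T.subdivision_adj_branch_iff β v).mp huv with h | ⟨z, hz, h⟩
    · rw [h]
      intro φ hφ
      rw [nodeMap_inr_inl, edgeMap_eq_of_branchMap_eq φ (huA φ hφ)]
    · rw [h]
      exact hmemA z (fun φ hφ => vertexMap_eq_of_branchMap_eq φ (huA φ hφ) hz)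

end SemiGraph

namespace ProfiniteSemiGraph

variable {𝒢 : ProfiniteSemiGraph.{u}}

/-! ### The two-level bridge: two compact subgroups sharing a certified element fix common vertices -/

/-- **TWO-LEVEL BRIDGE.**  Let `K₁, K₂ ≤ π₁^temp(𝒢)` be compact and `d ∈ K₁ ⊓ K₂` an element with an EDGE
CERTIFICATE: for every base edge `n` there is a level `M₀` such that for all `M ≥ M₀` the level-`M` component of
`d` fixes no edge of `𝒢_{∞,M}` over `n`.  Then at every level `m` the images of `K₁` and `K₂` fix a COMMON vertex
of `𝒢_{∞,m}` (all branches of `𝔾` are assumed to abut).  Proof: otherwise Lemma 1.8 (ii) gives an edge `e₀` of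
`𝒢_{∞,m}`, over `n₀` say, on every subdivision walk from a `K₁`-fixed to a `K₂`-fixed vertex; at a level
`M ≥ m, M₀(n₀)` the compact `K₁ ∋ d` fixes a vertex `v`, `K₂ ∋ d` fixes a vertex `w`, the geodesic `[v, w]` is
fixed node-wise by `d`, and its image in `𝒢_{∞,m}` passes `e₀` — so an edge of `[v, w]` over `n₀` is fixed by
`d`, against the certificate. [cite: MochizukiSemiAnbd2006, Lem. 1.8(ii)(b) p.20] -/
theorem exists_common_fixed_vertex_of_certificate (h36 : 𝒢.Prop36Hypotheses)
    (hcl : ∀ b : 𝒢.graph.Branch, ∃ w : 𝒢.graph.Vertex, 𝒢.graph.abuts b = some w)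
    (K₁ K₂ : Subgroup ((𝒢.galoisLevelData h36).temperedPi h36.isCountable))
    (hK₁ : IsCompact (K₁ : Set ((𝒢.galoisLevelData h36).temperedPi h36.isCountable)))
    (hK₂ : IsCompact (K₂ : Set ((𝒢.galoisLevelData h36).temperedPi h36.isCountable)))
    {d : (𝒢.galoisLevelData h36).temperedPi h36.isCountable} (hd₁ : d ∈ K₁) (hd₂ : d ∈ K₂)
    (hcert : ∀ n : 𝒢.graph.Edge, ∃ M₀ : ℕ, ∀ M, M₀ ≤ M → ∀ ε : ((𝒢.galoisLevelData h36).tree M).Edge,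
      ((𝒢.galoisLevelData h36).treeProj M).edgeMap ε = n →
        ((𝒢.galoisLevelData h36).treeAct h36.isCountable M d).hom.edgeMap ε ≠ ε)
    (m : ℕ) :
    ∃ z : ((𝒢.galoisLevelData h36).tree m).Vertex,
      (∀ k ∈ K₁, ((𝒢.galoisLevelData h36).treeAct h36.isCountable m k).hom.vertexMap z = z) ∧
      ∀ k ∈ K₂, ((𝒢.galoisLevelData h36).treeAct h36.isCountable m k).hom.vertexMap z = z := by
  classical
  let Dg := 𝒢.galoisLevelData h36
  have hc := h36.isCountable
  let D₀ : VerticialLevelData.{0} 𝒢 (𝒢.temperedPiChart h36) := verticialLevelData_temperedPiChart (h36 := h36)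
  by_contra hno
  push Not at hno
  -- fixed vertices of `K₁` and of `K₂` at level `m`
  obtain ⟨a₀, ha₀⟩ := D₀.exists_forall_mem_fixed_vertex_of_isCompact K₁ hK₁ m
  obtain ⟨b₀, hb₀⟩ := D₀.exists_forall_mem_fixed_vertex_of_isCompact K₂ hK₂ m
  -- all branches of the level trees abut (no open edges in `𝔾`)
  have hbr : ∀ (M : ℕ) (β : (Dg.tree M).Branch), ∃ z : (Dg.tree M).Vertex, (Dg.tree M).abuts β = some z := by
    intro M β
    obtain ⟨w, hw⟩ := hcl ((Dg.treeProj M).branchMap β)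
    exact Dg.exists_tree_abuts_eq_some M β hw
  -- the separating edge `e₀` of level `m` (tree bridge for the two families of level-`m` automorphisms)
  obtain ⟨e₀, he₀⟩ := SemiGraph.exists_edge_forall_walk_mem_support_of_family (Dg.isTree_tree m)
    ((fun k => Dg.treeAct hc m k) '' (K₁ : Set (Dg.temperedPi hc)))
    ((fun k => Dg.treeAct hc m k) '' (K₂ : Set (Dg.temperedPi hc))) (hbr m)
    (by
      rintro _ ⟨k, -, rfl⟩ e he β hβ
      exact SemiGraph.branchMap_eq_of_over_aut (Dg.treeProj m) (Dg.treeAct hc m k) (Dg.treeAct_over hc m k) β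
        (by rw [hβ]; exact he))
    (by
      rintro _ ⟨k, -, rfl⟩ e he β hβ
      exact SemiGraph.branchMap_eq_of_over_aut (Dg.treeProj m) (Dg.treeAct hc m k) (Dg.treeAct_over hc m k) β
        (by rw [hβ]; exact he))
    (a₀ := a₀) (b₀ := b₀)
    (by rintro _ ⟨k, hk, rfl⟩; exact ha₀ k hk) (by rintro _ ⟨k, hk, rfl⟩; exact hb₀ k hk)
    (by
      intro z hz hz'
      obtain ⟨k, hk, hne⟩ := hno z (fun k hk => hz _ ⟨k, hk, rfl⟩)
      exact hne (hz' _ ⟨k, hk, rfl⟩))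
  -- its base edge `n₀` and a deep level `M ≥ m` at which `d` fixes no edge over `n₀`
  obtain ⟨M₀, hM₀⟩ := hcert ((Dg.treeProj m).edgeMap e₀)
  obtain ⟨M, hmM, hM₀M⟩ : ∃ M : ℕ, m ≤ M ∧ M₀ ≤ M := ⟨max m M₀, le_max_left _ _, le_max_right _ _⟩
  -- at level `M`: a vertex `v` fixed by `K₁ ∋ d`, a vertex `w` fixed by `K₂ ∋ d`
  obtain ⟨v, hv⟩ := D₀.exists_forall_mem_fixed_vertex_of_isCompact K₁ hK₁ M
  obtain ⟨w, hw⟩ := D₀.exists_forall_mem_fixed_vertex_of_isCompact K₂ hK₂ M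
  have hvd : (Dg.treeAct hc M d).hom.vertexMap v = v := hv d hd₁
  have hwd : (Dg.treeAct hc M d).hom.vertexMap w = w := hw d hd₂
  -- the geodesic `[v, w]` of `𝒢_{∞,M}` is fixed node-wise by `d`
  obtain ⟨γ, hγp, -⟩ := ((Dg.isTree_tree M).isTree.connected
    (Sum.inl v : (Dg.tree M).Node) (Sum.inl w)).exists_path_of_dist
  have hγfix : ∀ x ∈ γ.support, SemiGraph.nodeMap (Dg.treeAct hc M d) x = x :=
    SemiGraph.nodeMap_eq_self_of_isPath (Dg.isTree_tree M).isTree.isAcyclic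
      (Dg.treeAct hc M d) (by rw [SemiGraph.nodeMap_inl, hvd]) (by rw [SemiGraph.nodeMap_inl, hwd]) γ hγp
  -- push it down to level `m`: a walk from the `K₁`-fixed vertex `π v` to the `K₂`-fixed vertex `π w`
  obtain ⟨ω, hω⟩ := SemiGraph.exists_walk_nodeMap (Dg.treeTrans hmM) γ
  have hπv : ∀ k ∈ K₁, (Dg.treeAct hc m k).hom.vertexMap ((Dg.treeTrans hmM).vertexMap v) =
      (Dg.treeTrans hmM).vertexMap v := by
    intro k hk
    have hvk : (Dg.treeAct hc M k).hom.vertexMap v = v := hv k hk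
    have h : (Dg.treeTrans hmM).vertexMap ((Dg.treeAct hc M k).hom.vertexMap v) =
        (Dg.treeAct hc m k).hom.vertexMap ((Dg.treeTrans hmM).vertexMap v) := D₀.trans_act_vertexMap hmM k v
    rw [hvk] at h
    exact h.symm
  have hπw : ∀ k ∈ K₂, (Dg.treeAct hc m k).hom.vertexMap ((Dg.treeTrans hmM).vertexMap w) =
      (Dg.treeTrans hmM).vertexMap w := by
    intro k hk
    have hwk : (Dg.treeAct hc M k).hom.vertexMap w = w := hw k hk
    have h : (Dg.treeTrans hmM).vertexMap ((Dg.treeAct hc M k).hom.vertexMap w) =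
        (Dg.treeAct hc m k).hom.vertexMap ((Dg.treeTrans hmM).vertexMap w) := D₀.trans_act_vertexMap hmM k w
    rw [hwk] at h
    exact h.symm
  -- the bridge: the walk passes through the edge-point `e₀`, i.e. some edge `eM` of `[v, w]` lies over `e₀`
  have hmem : (Sum.inr (Sum.inl e₀) : (Dg.tree m).Node) ∈ ω.support :=
    he₀ _ _ (by rintro _ ⟨k, hk, rfl⟩; exact hπv k hk) (by rintro _ ⟨k, hk, rfl⟩; exact hπw k hk) ω
  rw [hω, List.mem_map] at hmem
  obtain ⟨x, hx, hxe⟩ := hmem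
  obtain ⟨eM, rfl, heM⟩ := (SemiGraph.Hom.nodeMap_eq_edge_iff _ x e₀).mp hxe
  -- `eM` is fixed by `d` and lies over the base edge `n₀` of `e₀`
  have heMfix : (Dg.treeAct hc M d).hom.edgeMap eM = eM := by
    simpa only [SemiGraph.nodeMap_inr_inl, Sum.inr.injEq, Sum.inl.injEq] using hγfix _ hx
  have heMn : (Dg.treeProj M).edgeMap eM = (Dg.treeProj m).edgeMap e₀ := by
    have h := congrArg (fun φ => SemiGraph.Hom.edgeMap φ eM) (Dg.treeTrans_over hmM)
    simp only [SemiGraph.comp_edgeMap, Function.comp_apply, heM] at h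
    exact h.symm
  exact hM₀ M hM₀M eM heMn heMfix

/-- **The closed subgroup generated by two compact subgroups sharing a certified element is COMPACT**: its
level images lie in vertex-stabiliser images (abc-iut-L3-t6's `fixes_vertex_iff_exists_gal`), which are
finite, and a closed subgroup of `π₁^temp(𝒢) = lim_n Gal(𝒢_{∞,n}/𝒢)` with finite level images is compact
(`isCompact_of_isClosed_of_forall_finite_image`). [cite: MochizukiSemiAnbd2006, Thm 3.7(iv) p.41] -/
theorem isCompact_topologicalClosure_sup_of_certificate (h36 : 𝒢.Prop36Hypotheses)
    (hcl : ∀ b : 𝒢.graph.Branch, ∃ w : 𝒢.graph.Vertex, 𝒢.graph.abuts b = some w)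
    (K₁ K₂ : Subgroup ((𝒢.galoisLevelData h36).temperedPi h36.isCountable))
    (hK₁ : IsCompact (K₁ : Set ((𝒢.galoisLevelData h36).temperedPi h36.isCountable)))
    (hK₂ : IsCompact (K₂ : Set ((𝒢.galoisLevelData h36).temperedPi h36.isCountable)))
    {d : (𝒢.galoisLevelData h36).temperedPi h36.isCountable} (hd₁ : d ∈ K₁) (hd₂ : d ∈ K₂)
    (hcert : ∀ n : 𝒢.graph.Edge, ∃ M₀ : ℕ, ∀ M, M₀ ≤ M → ∀ ε : ((𝒢.galoisLevelData h36).tree M).Edge,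
      ((𝒢.galoisLevelData h36).treeProj M).edgeMap ε = n →
        ((𝒢.galoisLevelData h36).treeAct h36.isCountable M d).hom.edgeMap ε ≠ ε) :
    IsCompact (((K₁ ⊔ K₂).topologicalClosure :
      Subgroup ((𝒢.galoisLevelData h36).temperedPi h36.isCountable)) :
        Set ((𝒢.galoisLevelData h36).temperedPi h36.isCountable)) := by
  classical
  let Dg := 𝒢.galoisLevelData h36
  have hc := h36.isCountable
  let K' : Subgroup (Dg.temperedPi hc) := (K₁ ⊔ K₂).topologicalClosure
  have hfin : ∀ m, (Dg.proj hc m '' (K' : Set (Dg.temperedPi hc))).Finite := by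
    intro m
    obtain ⟨z, hz₁, hz₂⟩ := exists_common_fixed_vertex_of_certificate h36 hcl K₁ K₂ hK₁ hK₂ hd₁ hd₂ hcert m
    obtain ⟨T, hT⟩ : ∃ T : Dg.PointSeq hc ((Dg.treeProj m).vertexMap z), T.vertex m = z :=
      exists_pointSeq_vertex_eq_galoisLevelData h36 m z
    -- the finite image `R` of the decomposition group `ψ_T(Π_w)` at level `m`
    let R : Subgroup (Dg.Gal hc m) := (T.decompHom.range).map (Dg.proj hc m)
    have hRfin : (R : Set (Dg.Gal hc m)).Finite := by
      have h2 : IsCompact (Dg.proj hc m '' Set.range T.decompHom) :=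
        (isCompact_range T.continuous_decompHom).image (Dg.continuous_proj hc m)
      have h3 : (R : Set (Dg.Gal hc m)) = Dg.proj hc m '' Set.range T.decompHom := by
        change (((T.decompHom.range).map (Dg.proj hc m) : Subgroup (Dg.Gal hc m)) : Set (Dg.Gal hc m)) = _
        rw [Subgroup.coe_map, MonoidHom.coe_range]
      exact h3 ▸ h2.finite_of_discrete
    have hmemR : ∀ g : Dg.temperedPi hc, (Dg.treeAct hc m g).hom.vertexMap z = z → Dg.proj hc m g ∈ R := by
      intro g hg
      rw [← hT] at hg
      obtain ⟨kk, hkk⟩ := (T.fixes_vertex_iff_exists_gal m g).mp hg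
      exact Subgroup.mem_map.mpr ⟨T.decompHom kk, ⟨kk, rfl⟩, (T.proj_decompHom m kk).trans hkk⟩
    have hle : (K₁ ⊔ K₂).map (Dg.proj hc m) ≤ R := by
      rw [Subgroup.map_le_iff_le_comap]
      refine sup_le (fun x hx => ?_) (fun x hx => ?_)
      · exact hmemR _ (hz₁ x hx)
      · exact hmemR _ (hz₂ x hx)
    refine hRfin.subset ?_
    rintro _ ⟨x, hx, rfl⟩
    have h1 := image_closure_subset_closure_image (Dg.continuous_proj hc m)
      ⟨x, (by rw [← Subgroup.topologicalClosure_coe]; exact hx), rfl⟩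
    rw [(isClosed_discrete _).closure_eq] at h1
    obtain ⟨x', hx'', hxx'⟩ := h1
    exact hxx' ▸ hle (Subgroup.mem_map.mpr ⟨x', hx'', rfl⟩)
  exact Dg.isCompact_of_isClosed_of_forall_finite_image hc (K' : Set (Dg.temperedPi hc))
    (Subgroup.isClosed_topologicalClosure _) hfin

/-- **A maximal compact subgroup CONTAINS every compact subgroup with which it shares a certified element**:
if `K₂` is a maximal compact subgroup of `π₁^temp(𝒢)`, `K₁` is compact and `d ∈ K₁ ⊓ K₂` carries an edge
certificate, then `K₁ ≤ K₂` (`K₂ ≤ (K₁ ⊔ K₂)‾`, compact, so equal to `K₂`).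
[cite: MochizukiSemiAnbd2006, Thm 3.7(iv) p.41] -/
theorem le_of_isMaximalCompactSubgroup_of_certificate (h36 : 𝒢.Prop36Hypotheses)
    (hcl : ∀ b : 𝒢.graph.Branch, ∃ w : 𝒢.graph.Vertex, 𝒢.graph.abuts b = some w)
    (K₁ K₂ : Subgroup ((𝒢.galoisLevelData h36).temperedPi h36.isCountable))
    (hK₁ : IsCompact (K₁ : Set ((𝒢.galoisLevelData h36).temperedPi h36.isCountable)))
    (hK₂ : IsMaximalCompactSubgroup K₂)
    {d : (𝒢.galoisLevelData h36).temperedPi h36.isCountable} (hd₁ : d ∈ K₁) (hd₂ : d ∈ K₂)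
    (hcert : ∀ n : 𝒢.graph.Edge, ∃ M₀ : ℕ, ∀ M, M₀ ≤ M → ∀ ε : ((𝒢.galoisLevelData h36).tree M).Edge,
      ((𝒢.galoisLevelData h36).treeProj M).edgeMap ε = n →
        ((𝒢.galoisLevelData h36).treeAct h36.isCountable M d).hom.edgeMap ε ≠ ε) :
    K₁ ≤ K₂ := by
  have hcpt := isCompact_topologicalClosure_sup_of_certificate h36 hcl K₁ K₂ hK₁ hK₂.1 hd₁ hd₂ hcert
  have hle₂ : K₂ ≤ (K₁ ⊔ K₂).topologicalClosure := le_sup_right.trans (Subgroup.le_topologicalClosure _)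
  have heq := hK₂.2 _ hcpt hle₂
  exact (le_sup_left.trans (Subgroup.le_topologicalClosure _)).trans heq.le

end ProfiniteSemiGraph

end Literature.AnabelianGeometry.SemiGraphs

end
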